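import Mathlib
import Summits.Ventures.HodgeRepro2.BallAnalytic
import Summits.Ventures.HodgeRepro2.DeckRigidity
import Summits.Ventures.HodgeRepro2.BallQuotientCovering
import Summits.Ventures.HodgeRepro2.BallQuotientHausdorff
import Summits.Ventures.HodgeRepro2.BallQuotientFiniteCover

/-!
# `Γ\𝔹²` is a complex manifold

Kernel annex of the blind cell `pub-hodge-repro2` (seat p2), Tier-3 hypothesis shapes of
`Hypothesis.lean`.  The transfer of the brief works on the compact quotient `Γ\𝔹²` of the
complex 2-ball by a torsion-free congruence subgroup `Γ ⊆ Γ_N` (Shimura 1979 §4 and Thm 8.1;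
DR15 §2: `Y_Γ = Γ\𝔹²` is a smooth projective surface for `Γ` neat / torsion-free).  This file
records the COMPLEX-ANALYTIC half of that sentence in Mathlib's language:

* `ballQuotientChartedSpace`: once the quotient map `𝔹² → Γ\𝔹²` is a local homeomorphism
  (a covering map for torsion-free `Γ`, `BallQuotientCovering.lean`), the ball's single chart
  pushes forward to an atlas of `Γ\𝔹²` modelled on `ℂ²` (Mathlib `IsLocalHomeomorph.chartedSpace`);
* `transition_eventuallyEq`: every transition map of this atlas agrees, near each point of its
  source, with the ball action of ONE element `γ ∈ Γ` (deck transformations are locally constant,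
  `DeckRigidity.lean`);
* `isManifold_ballQuotient`: hence `Γ\𝔹²` is an analytic complex manifold
  (`IsManifold 𝓘(ℂ, Fin 2 → ℂ) ω`), the ball action being `C^ω` (`BallAnalytic.lean`);
* `contMDiff_ballQuotient_mk`: the quotient map is holomorphic (`C^ω`) for this structure;
* the instantiations `isManifold_ballQuotient_of_isTorsionFreeSet` (any torsion-free
  `Γ ⊆ Γ_N`, the `Γ` of `NonVanishingInput`) and `isManifold_ballQuotient_shimuraLevel`
  (Shimura's `Γ_N`, `N > 2`).

Together with `BallQuotientHausdorff.lean` (`T2Space`, `SecondCountableTopology`,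
`LocallyCompactSpace`) this is the statement «`Γ\𝔹²` is a complex surface»; compactness is the
separate arithmetic input (anisotropy of `H`) and is not claimed here.
-/

namespace Summit.Ventures.HodgeRepro2.ShimuraData

open scoped ContDiff Manifold
open Topology Filter

variable {K : Type*} [Field K] [NumberField K] [NumberField.IsCMField K]
  {τ₁ : K →+* ℂ} {H : Matrix (Fin 3) (Fin 3) K} {Q : Matrix (Fin 3) (Fin 3) ℂ}
  (hQ : IsFrame K τ₁ H Q) (S : Subgroup (GL (Fin 3) K))
  (hS : (S : Set (GL (Fin 3) K)) ⊆ (unitaryGroup K H : Set (GL (Fin 3) K)))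

/-- The charted-space structure on `Γ\𝔹²` pushed forward from the ball along the quotient
map, available as soon as the quotient map is a local homeomorphism (a covering map for
torsion-free `Γ`). -/
@[reducible] noncomputable def ballQuotientChartedSpace (hf : IsLocalHomeomorph (ballQuotient.mk hQ S hS)) :
    ChartedSpace (Fin 2 → ℂ) (ballQuotient hQ S hS) :=
  hf.chartedSpace (ballQuotient_mk_surjective hQ S hS)

/-- Every chart of the pushed-forward atlas is a local inverse of the quotient map at some point
`z` of the ball, followed by the (inclusion) chart of the ball. -/
theorem exists_eq_of_mem_atlas_ballQuotientChartedSpace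
    (hf : IsLocalHomeomorph (ballQuotient.mk hQ S hS))
    {e : OpenPartialHomeomorph (ballQuotient hQ S hS) (Fin 2 → ℂ)}
    (he : e ∈ @atlas (Fin 2 → ℂ) _ (ballQuotient hQ S hS) _ (ballQuotientChartedSpace hQ S hS hf)) :
    ∃ z : ball₂, e = (hf.localInverseAt z).trans (chartAt (Fin 2 → ℂ) z) := by
  obtain ⟨q, hq⟩ := he
  exact ⟨_, hq.symm⟩

/-- The chart of the pushed-forward atlas at a point `x` of `Γ\𝔹²` is a local inverse of the
quotient map at some `z` with `x` in its source, followed by the chart of the ball. -/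
theorem exists_chartAt_eq_ballQuotientChartedSpace
    (hf : IsLocalHomeomorph (ballQuotient.mk hQ S hS)) (x : ballQuotient hQ S hS) :
    ∃ z : ball₂, x ∈ (hf.localInverseAt z).source ∧
      @chartAt (Fin 2 → ℂ) _ (ballQuotient hQ S hS) _ (ballQuotientChartedSpace hQ S hS hf) x =
        (hf.localInverseAt z).trans (chartAt (Fin 2 → ℂ) z) := by
  letI := ballQuotientChartedSpace hQ S hS hf
  obtain ⟨z, hz⟩ := exists_eq_of_mem_atlas_ballQuotientChartedSpace hQ S hS hf
    (chart_mem_atlas (Fin 2 → ℂ) x)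
  refine ⟨z, ?_, hz⟩
  have hx := mem_chart_source (Fin 2 → ℂ) x
  rw [hz, OpenPartialHomeomorph.trans_source] at hx
  exact hx.1

/-- The transition map between the pushed-forward charts at `z` and `z'`, evaluated at a point
`w` of the ball: go down to the ball, up to `Γ\𝔹²` by the quotient map, back to the ball by the
local inverse at `z'`. -/
theorem ballQuotient_transition_apply (hf : IsLocalHomeomorph (ballQuotient.mk hQ S hS))
    (z z' : ball₂) (w : Fin 2 → ℂ) :
    (((hf.localInverseAt z).trans (chartAt (Fin 2 → ℂ) z)).symm.trans
        ((hf.localInverseAt z').trans (chartAt (Fin 2 → ℂ) z'))) w =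
      ((hf.localInverseAt z') (ballQuotient.mk hQ S hS ((chartAt (Fin 2 → ℂ) z).symm w)) :
        Fin 2 → ℂ) := by
  simp only [OpenPartialHomeomorph.coe_trans, OpenPartialHomeomorph.coe_trans_symm,
    Function.comp_apply, hf.localInverseAt_symm, ball₂.coe_chartAt]

/-- The fibres of the quotient map are the `Γ`-orbits (the form of `ballQuotient_mk_eq_mk_iff`
used by `DeckRigidity`). -/
theorem ballQuotient_mk_eq_mk_iff_exists_smul (x x' : ball₂) :
    letI := frameAction hQ S hS
    ballQuotient.mk hQ S hS x = ballQuotient.mk hQ S hS x' ↔ ∃ γ : S, γ • x = x' := by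
  letI := frameAction hQ S hS
  rw [ballQuotient_mk_eq_mk_iff]
  constructor
  · rintro ⟨γ, hγ⟩
    refine ⟨γ⁻¹, ?_⟩
    have h1 : γ • x' = x := Subtype.ext (by rw [frameAction_smul_coe, hγ])
    rw [← h1, inv_smul_smul]
  · rintro ⟨γ, hγ⟩
    refine ⟨γ⁻¹, ?_⟩
    rw [← hγ, ← frameAction_smul_coe hQ S hS γ⁻¹, inv_smul_smul]

/-- **Deck transformations are locally constant.** Near every point `w₀` of the ball at which
the transition map between the charts at `z` and `z'` is defined (`w₀ ∈ 𝔹²` and the image of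
`w₀` in `Γ\𝔹²` lies in the source of the local inverse at `z'`), the transition map agrees with
the ball action of a single element `γ ∈ Γ`. -/
theorem ballQuotient_transition_eventuallyEq (hf : IsLocalHomeomorph (ballQuotient.mk hQ S hS))
    (z z' : ball₂) {w₀ : Fin 2 → ℂ} (hw₀ : w₀ ∈ ball₂)
    (hsrc : ballQuotient.mk hQ S hS ((chartAt (Fin 2 → ℂ) z).symm w₀) ∈
      (hf.localInverseAt z').source) :
    ∃ γ : S, ⇑(((hf.localInverseAt z).trans (chartAt (Fin 2 → ℂ) z)).symm.trans
        ((hf.localInverseAt z').trans (chartAt (Fin 2 → ℂ) z'))) =ᶠ[𝓝 w₀]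
      ballAction (realEmbedding K τ₁ Q ↑γ) := by
  letI := frameAction hQ S hS
  haveI := continuousConstSMul_frameAction hQ S hS
  set c := chartAt (Fin 2 → ℂ) z with hc
  let u : (Fin 2 → ℂ) → ball₂ := fun w => c.symm w
  let v : (Fin 2 → ℂ) → ball₂ := fun w => hf.localInverseAt z' (ballQuotient.mk hQ S hS (c.symm w))
  have hw₀t : w₀ ∈ c.target := by rw [hc, ball₂.chartAt_target]; exact hw₀
  have hu : ContinuousAt u w₀ := c.continuousAt_symm hw₀t
  have hmu : ContinuousAt (fun w => ballQuotient.mk hQ S hS (u w)) w₀ :=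
    ContinuousAt.comp (g := ballQuotient.mk hQ S hS) (f := u) hf.continuous.continuousAt hu
  have hv : ContinuousAt v w₀ :=
    ContinuousAt.comp (g := hf.localInverseAt z') (f := fun w => ballQuotient.mk hQ S hS (u w))
      ((hf.localInverseAt z').continuousAt hsrc) hmu
  have huv : ∀ᶠ w in 𝓝 w₀, ballQuotient.mk hQ S hS (u w) = ballQuotient.mk hQ S hS (v w) := by
    have hopen : (hf.localInverseAt z').source ∈ 𝓝 (ballQuotient.mk hQ S hS (u w₀)) :=
      (hf.localInverseAt z').open_source.mem_nhds hsrc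
    filter_upwards [hmu.preimage_mem_nhds hopen] with w hw
    exact (hf.apply_localInverseAt_of_mem hw).symm
  obtain ⟨γ, hγ⟩ := DeckRigidity.eventually_eq_smul_of_isLocalHomeomorph_of_fibres hf
    (ballQuotient_mk_eq_mk_iff_exists_smul hQ S hS) hu hv huv
  refine ⟨γ, ?_⟩
  filter_upwards [hγ, isOpen_ball₂.mem_nhds hw₀] with w hw hwb
  rw [ballQuotient_transition_apply hQ S hS hf z z' w]
  change ((v w : ball₂) : Fin 2 → ℂ) = _
  rw [hw, frameAction_smul_coe]
  change ballAction _ ((c.symm w : ball₂) : Fin 2 → ℂ) = _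
  rw [hc, ball₂.coe_chartAt_symm_apply z hwb]

/-- A point of the source of a transition map lies in the ball and its image in `Γ\𝔹²` lies in
the source of the second local inverse. -/
theorem mem_ball₂_and_mem_source_of_mem_transition_source
    (hf : IsLocalHomeomorph (ballQuotient.mk hQ S hS)) (z z' : ball₂) {w₀ : Fin 2 → ℂ}
    (hw₀ : w₀ ∈ (((hf.localInverseAt z).trans (chartAt (Fin 2 → ℂ) z)).symm.trans
        ((hf.localInverseAt z').trans (chartAt (Fin 2 → ℂ) z'))).source) :
    w₀ ∈ ball₂ ∧ ballQuotient.mk hQ S hS ((chartAt (Fin 2 → ℂ) z).symm w₀) ∈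
      (hf.localInverseAt z').source := by
  simp only [OpenPartialHomeomorph.trans_source, OpenPartialHomeomorph.symm_source,
    OpenPartialHomeomorph.trans_target, Set.mem_inter_iff, Set.mem_preimage,
    OpenPartialHomeomorph.coe_trans_symm, Function.comp_apply, hf.localInverseAt_symm] at hw₀
  obtain ⟨⟨hw₀b, -⟩, hsrc, -⟩ := hw₀
  rw [ball₂.chartAt_target] at hw₀b
  exact ⟨hw₀b, hsrc⟩

/-- **`Γ\𝔹²` is an analytic complex manifold modelled on `ℂ²`**, for the atlas pushed forward
from the ball, as soon as the quotient map is a local homeomorphism: the transition maps are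
locally ball actions of elements of `Γ ⊆ U(2,1)`, which are `C^ω`. -/
theorem isManifold_ballQuotient (hf : IsLocalHomeomorph (ballQuotient.mk hQ S hS)) :
    @IsManifold ℂ _ (Fin 2 → ℂ) _ _ (Fin 2 → ℂ) _ 𝓘(ℂ, Fin 2 → ℂ) ω (ballQuotient hQ S hS) _
      (ballQuotientChartedSpace hQ S hS hf) := by
  letI := ballQuotientChartedSpace hQ S hS hf
  refine isManifold_of_contDiffOn 𝓘(ℂ, Fin 2 → ℂ) ω (ballQuotient hQ S hS) fun e e' he he' => ?_
  obtain ⟨z, rfl⟩ := exists_eq_of_mem_atlas_ballQuotientChartedSpace hQ S hS hf he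
  obtain ⟨z', rfl⟩ := exists_eq_of_mem_atlas_ballQuotientChartedSpace hQ S hS hf he'
  simp only [modelWithCornersSelf_coe, modelWithCornersSelf_coe_symm, Function.comp_id,
    Function.id_comp, Set.preimage_id, Set.range_id, Set.inter_univ]
  intro w₀ hw₀
  obtain ⟨hw₀b, hsrc⟩ := mem_ball₂_and_mem_source_of_mem_transition_source hQ S hS hf z z' hw₀
  obtain ⟨γ, hγ⟩ := ballQuotient_transition_eventuallyEq hQ S hS hf z z' hw₀b hsrc
  have hγU : IsInU21 (realEmbedding K τ₁ Q ↑γ) := hQ.isInU21_realEmbedding (hS γ.2)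
  exact ((hγU.contDiffAt_ballAction hw₀b).congr_of_eventuallyEq hγ).contDiffWithinAt

/-- The quotient map `𝔹² → Γ\𝔹²` is holomorphic (`C^ω`) for the pushed-forward structure. -/
theorem contMDiff_ballQuotient_mk (hf : IsLocalHomeomorph (ballQuotient.mk hQ S hS)) :
    @ContMDiff ℂ _ (Fin 2 → ℂ) _ _ (Fin 2 → ℂ) _ 𝓘(ℂ, Fin 2 → ℂ) ball₂ _ _
      (Fin 2 → ℂ) _ _ (Fin 2 → ℂ) _ 𝓘(ℂ, Fin 2 → ℂ) (ballQuotient hQ S hS) _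
      (ballQuotientChartedSpace hQ S hS hf) ω (ballQuotient.mk hQ S hS) := by
  letI := ballQuotientChartedSpace hQ S hS hf
  intro z
  rw [contMDiffAt_iff]
  refine ⟨hf.continuous.continuousAt, ?_⟩
  obtain ⟨z', hz'src, hz'⟩ := exists_chartAt_eq_ballQuotientChartedSpace hQ S hS hf
    (ballQuotient.mk hQ S hS z)
  simp only [extChartAt, OpenPartialHomeomorph.extend, modelWithCornersSelf_coe,
    modelWithCornersSelf_coe_symm, PartialEquiv.coe_trans, ModelWithCorners.toPartialEquiv_coe,
    OpenPartialHomeomorph.coe_toPartialEquiv, ModelWithCorners.toPartialEquiv_coe_symm,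
    PartialEquiv.coe_trans_symm, OpenPartialHomeomorph.coe_toPartialEquiv_symm, Set.range_id,
    contDiffWithinAt_univ, Function.comp_id, Function.id_comp]
  rw [hz', ball₂.coe_chartAt]
  have hzb : (z : Fin 2 → ℂ) ∈ ball₂ := z.2
  have hsrc : ballQuotient.mk hQ S hS ((chartAt (Fin 2 → ℂ) z).symm (z : Fin 2 → ℂ)) ∈
      (hf.localInverseAt z').source := by
    have : (chartAt (Fin 2 → ℂ) z).symm (z : Fin 2 → ℂ) = z :=
      Subtype.ext (ball₂.coe_chartAt_symm_apply z hzb)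
    rw [this]
    exact hz'src
  obtain ⟨γ, hγ⟩ := ballQuotient_transition_eventuallyEq hQ S hS hf z z' hzb hsrc
  have hγU : IsInU21 (realEmbedding K τ₁ Q ↑γ) := hQ.isInU21_realEmbedding (hS γ.2)
  refine (hγU.contDiffAt_ballAction hzb).congr_of_eventuallyEq (Filter.EventuallyEq.trans ?_ hγ)
  filter_upwards [isOpen_ball₂.mem_nhds hzb] with w _
  show ((hf.localInverseAt z').trans (chartAt (Fin 2 → ℂ) z'))
    (ballQuotient.mk hQ S hS ((chartAt (Fin 2 → ℂ) z).symm w)) = _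
  rw [ballQuotient_transition_apply hQ S hS hf z z' w, OpenPartialHomeomorph.coe_trans,
    Function.comp_apply, ball₂.coe_chartAt]

section instantiation

variable {hQ S}

/-- **`Γ\𝔹²` is a complex manifold for every torsion-free `Γ ⊆ Γ_N`** (the `Γ` of
`NonVanishingInput`, for `H` definite away from `τ₁`), with the atlas pushed forward along the
covering map `𝔹² → Γ\𝔹²` of `BallQuotientCovering.lean`. -/
theorem isManifold_ballQuotient_of_isTorsionFreeSet (hH : IsHermitianForm K H)
    (hdef : ∀ τ : K →+* ℂ, NumberField.InfinitePlace.mk τ ≠ NumberField.InfinitePlace.mk τ₁ →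
      IsDefiniteAt K τ H)
    {𝔪 : Submodule ℤ (Fin 3 → K)} (h𝔪 : IsLattice K 𝔪) {N : ℕ}
    (hS : ↑S ⊆ shimuraLevel K H 𝔪 N) (htf : IsTorsionFreeSet K (S : Set (GL (Fin 3) K))) :
    @IsManifold ℂ _ (Fin 2 → ℂ) _ _ (Fin 2 → ℂ) _ 𝓘(ℂ, Fin 2 → ℂ) ω
      (ballQuotient hQ S (subset_unitaryGroup_of_subset_shimuraLevel hS)) _
      (ballQuotientChartedSpace hQ S (subset_unitaryGroup_of_subset_shimuraLevel hS)
        (isCoveringMap_ballQuotient_mk_of_isTorsionFreeSet hH hdef hQ h𝔪 hS htf).isLocalHomeomorph) :=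
  isManifold_ballQuotient hQ S _ _

/-- **Shimura's `Γ_N\𝔹²` is a complex manifold for `N > 2`** (`Γ_N` is torsion-free:
`BallFreeAction.lean`). -/
theorem isManifold_ballQuotient_shimuraLevel (hH : IsHermitianForm K H)
    (hdef : ∀ τ : K →+* ℂ, NumberField.InfinitePlace.mk τ ≠ NumberField.InfinitePlace.mk τ₁ →
      IsDefiniteAt K τ H)
    {𝔪 : Submodule ℤ (Fin 3 → K)} (h𝔪 : IsLattice K 𝔪) {N : ℕ} (hN : 2 < N) :
    @IsManifold ℂ _ (Fin 2 → ℂ) _ _ (Fin 2 → ℂ) _ 𝓘(ℂ, Fin 2 → ℂ) ω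
      (ballQuotient hQ (shimuraLevelSubgroup K H 𝔪 N) _) _
      (ballQuotientChartedSpace hQ (shimuraLevelSubgroup K H 𝔪 N) _
        (isCoveringMap_ballQuotient_mk_shimuraLevel hH hdef hQ h𝔪 hN).isLocalHomeomorph) :=
  isManifold_ballQuotient hQ _ _ _

end instantiation

end Summit.Ventures.HodgeRepro2.ShimuraData
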